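import Summits.SmoothPoincare4.SmoothPoincare4.Theorems.SymplecticOrigamiGromovRecognitionRelEndHelperNormalVelocityDichotomy

/-!
# Split piece `LocalFoliationEmbeddedSpheres` (crux stmt-SmoothPoincare4-16778): the birth stub
`stub_normalVelocityDichotomy` is PROVED

The birth skeleton `Cruxes/GromovRecognitionRelEnd/SplitLocalFoliationBirth.lean` of the split piece
`LocalFoliationEmbeddedSpheres` (Hofer–Lizan–Sikorav / Wendl 2018 Prop. 2.53, `m = 0`: local foliation by
embedded `J`-spheres with trivial normal bundle) registered three stubs on item stmt-SmoothPoincare4-16778.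
`stub_immersionCriterion` landed earlier (p148756).  This file proves the second one,
`stub_normalVelocityDichotomy` — for every smooth `J`-holomorphic family through the embedded sphere and every
direction, the normal velocity read through the trivialising submersion `πN` is identically zero or nowhere
zero (Wendl 2018 Prop. 2.47 / §2.4–2.5: solutions of the normal linearised Cauchy–Riemann equation have
isolated zeros of positive index, and their total is `c₁(N) = 0`) — VERBATIM, by the registered helper
`helper_normalVelocityDichotomy` of the parent crux's line `cross-cap-laurent`
(`…HelperNormalVelocityDichotomy.lean`, lead c6 of stmt-SmoothPoincare4-11009), which assembles: the
linearised Cauchy–Riemann equation of the family and the `∂̄`-inequality for its complex normal coordinate,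
the similarity principle, the orientation sign of `dπN` relative to `J` and its constancy along the sphere,
and the vanishing of the total index of a function on the sphere.

What remains open in the piece is the existence stub `stub_deformationFamily` (XL; nonlinear Fredholm
theory / automatic transversality).

References: C. Wendl, *Holomorphic Curves in Low Dimensions*, LNM 2216 (2018), Prop. 2.53, Prop. 2.47,
§2.4–2.5; H. Hofer, V. Lizan, J.-C. Sikorav, J. Geom. Anal. 7 (1997), Thm. 1.  No new definitions,
notation or instances.
-/

open scoped Manifold ContDiff Topology
open Set Function Filter
open Literature.Geometry.Symplectic

-- the prescribed namespace `Summit.<P>.<Sub>.…` duplicates `SmoothPoincare4` (P = Sub)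
set_option linter.dupNamespace false

namespace Summit.SmoothPoincare4.SmoothPoincare4.Theorems.LocalFoliationEmbeddedSpheres

/-- **Birth stub `stub_normalVelocityDichotomy` of the split piece `LocalFoliationEmbeddedSpheres`
(stmt-SmoothPoincare4-16778), proved:** the normal velocity of a smooth `J`-holomorphic family of
two-chart spheres through an embedded `J`-sphere with trivial normal bundle, read through the
trivialising submersion, is identically zero or nowhere zero (the registered helper
`helper_normalVelocityDichotomy` of line `cross-cap-laurent` of the parent crux `GromovRecognitionRelEnd`).
[cite: Wendl2018, Prop. 2.53 and Prop. 2.47] -/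
theorem stub_normalVelocityDichotomy : ∀ (X : Type) [TopologicalSpace X] [T2Space X] [SecondCountableTopology X] [ChartedSpace (EuclideanSpace ℝ (Fin 4)) X] [IsManifold (𝓡 4) ∞ X] (JX : AlmostComplexStructure (𝓡 4) ∞ X) (u₀ v₀ : ℂ → X) (N : Set X) (πN : X → ℂ), ContMDiff 𝓘(ℝ, ℂ) (𝓡 4) ∞ u₀ → ContMDiff 𝓘(ℝ, ℂ) (𝓡 4) ∞ v₀ → (∀ z : ℂ, z ≠ 0 → v₀ z = u₀ z⁻¹) → IsJHolomorphic (𝓡 4) (fun y => JX y) u₀ → IsJHolomorphic (𝓡 4) (fun y => JX y) v₀ → Injective u₀ → (∀ z, Injective (mfderiv 𝓘(ℝ, ℂ) (𝓡 4) u₀ z)) → Injective (mfderiv 𝓘(ℝ, ℂ) (𝓡 4) v₀ 0) → v₀ 0 ∉ range u₀ → IsOpen N → range u₀ ∪ {v₀ 0} ⊆ N → ContMDiffOn (𝓡 4) 𝓘(ℝ, ℂ) ∞ πN N → (∀ y ∈ N, Surjective (mfderiv (𝓡 4) 𝓘(ℝ, ℂ) πN y)) → {y | y ∈ N ∧ πN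 y = 0} = range u₀ ∪ {v₀ 0} → ∀ (ε : ℝ) (U V : ℂ → ℂ → X), 0 < ε → (∀ z, U 0 z = u₀ z) → (∀ w, V 0 w = v₀ w) → (∀ a : ℂ, ‖a‖ < ε → (∀ z : ℂ, z ≠ 0 → V a z = U a z⁻¹) ∧ IsJHolomorphic (𝓡 4) (fun y => JX y) (U a) ∧ IsJHolomorphic (𝓡 4) (fun y => JX y) (V a)) → ContMDiffOn 𝓘(ℝ, ℂ × ℂ) (𝓡 4) ∞ (fun q : ℂ × ℂ => U q.1 q.2) (Metric.ball 0 ε ×ˢ univ) → ContMDiffOn 𝓘(ℝ, ℂ × ℂ) (𝓡 4) ∞ (fun q : ℂ × ℂ => V q.1 q.2) (Metric.ball 0 ε ×ˢ univ) → ∀ c : ℂ, ((∀ z, (fderiv ℝ (fun a : ℂ => πN (U a z)) 0) c = 0) ∧ (∀ w, (fderiv ℝ (fun a : ℂ => πN (V a w)) 0) c = 0)) ∨ ((∀ z, (fderiv ℝ (fun a : ℂ => πN (U a z)) 0) c ≠ 0) ∧ (∀ w, (fderiv ℝ (fun a : ℂ => πN (V a w)) 0) c ≠ 0)) :=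
  Summit.SmoothPoincare4.SmoothPoincare4.Theorems.GromovRecognitionRelEnd.CrossCapLaurent.helper_normalVelocityDichotomy

end Summit.SmoothPoincare4.SmoothPoincare4.Theorems.LocalFoliationEmbeddedSpheres
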